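import Mathlib.Tactic
import HarnessLib
import Literature.Probability.LatticeModels.StrassenHolleyCoupling

/-!
# Kozma–Nitzan's Question 8 at three relays — THEOREM K̂-TREES, the tensorisation step:
# the two-row cone `{t1 ≥ t5, t1 + s3 ≥ t5 + t3}` is preserved under PRODUCTS of blocks (abstract, no certificates)

Support file (`--supports stmt-CriticalPhenomena-4575`, closed crux; independent mathematics on Kozma–Nitzan's Question 8,
arXiv:2401.12397 §5.5 p. 36), prover `prim-ineq-gen-6` (gen 19).  No definitions, no named facts, no sorries; standard axioms.
Memo `run/shared/lean/prim/prim-ineq-gen-6/PROOF-KHAT-TREES-G19.md` §4, §6 (THEOREM K̂-TREES: the all-κ=1 3-copy coefficients of the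
centring functional are nonnegative whenever the marker's inner component is a tree).  In the K̂ route (gen 18, PROOF-KHAT-G18) the
coefficient functional is bounded below by `Σ_σ K̂(σ)·G₁(σ)`, `K̂ = Z²A_vC_v²·[(t1 − t5) + Z A_v (s3 − t3)]`, where every channel is a PRODUCT over
the pendant blocks of per-block tables on the block's pseudo-state poset, and `G₁` is monotone on the product poset; so `K̂ ≽ 0` (nonnegative mass on
every up-set of the product poset) suffices (layer cake, `Literature…sum_mul_nonneg_of_upperSets`).  Gen 18 closed the induction over blocks with
exact certificates per block type.  This file kernel-checks that NO certificate is needed: for finite preorders `α`, `β` and per-factor channel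
functions `a,b,c,d` (resp. `A,B,C,D`) with the pointwise rows `0 ≤ b ≤ a`, `0 ≤ d ≤ c` and the up-set rows `a − c ≽ 0`, `a − c − b + d ≽ 0`, the
products `aA, bB, cC, dD` on `α × β` (product order) satisfy the same rows (`khatCone_R1_prod`, `khatCone_R2_prod`), via the identities
`aA − cC = (a−c)A + c(A−C)` and `aA − cC − bB + dD = (a−c)(A−B) + (a−c−b+d)B + (c−d)(A−C) + d(A−C−B+D)` summed fibrewise over an up-set and the
layer cake.  The two transport lemmas `upperSets_nonneg_prod_of_nonneg_right/left` and the 'sub-mean' product `subMean_prod` (memo Lemma 6(ii),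
the engine of THEOREM A there) are recorded on the way.  (t1 = a, t3 = b, t5 = c, s3 = d.)
[cite: KozmaNitzan2024, Question 8 (§5.5 p. 36)]
-/

namespace Summit.CriticalPhenomena.PercolationContinuityZ3.Theorems

namespace PocketCert

open Finset

variable {α β : Type*} [Fintype α] [Preorder α] [Fintype β] [Preorder β]

omit [Preorder α] [Preorder β] in
/-- Fibrewise summation of a product function over a subset of `α × β`. [cite: KozmaNitzan2024, Question 8 (§5.5 p. 36)] -/
theorem sum_mul_eq_sum_fib [DecidableEq α] [DecidableEq β] (U : Finset (α × β)) (f : α → ℝ) (g : β → ℝ) :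
    ∑ p ∈ U, f p.1 * g p.2 = ∑ a, f a * ∑ b ∈ univ.filter (fun b => (a, b) ∈ U), g b := by
  classical
  have h1 : ∑ p ∈ U, f p.1 * g p.2 = ∑ p : α × β, if p ∈ U then f p.1 * g p.2 else 0 := by
    rw [← Finset.sum_filter, Finset.filter_univ_mem]
  rw [h1, Fintype.sum_prod_type]
  refine Finset.sum_congr rfl fun a _ => ?_
  rw [Finset.sum_filter, Finset.mul_sum]
  refine Finset.sum_congr rfl fun b _ => ?_
  split_ifs <;> simp

omit [Fintype α] [Fintype β] in
/-- The fibre of an up-set of `α × β` over a point is an up-set of `β`. [cite: KozmaNitzan2024, Question 8 (§5.5 p. 36)] -/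
theorem fib_isUpperSet_of_isUpperSet [Fintype β] [DecidableEq α] [DecidableEq β] (U : Finset (α × β))
    (hU : IsUpperSet (U : Set (α × β))) (a : α) :
    IsUpperSet ((univ.filter fun b => (a, b) ∈ U : Finset β) : Set β) := by
  intro b b' hbb' hb
  have hb2 : (a, b) ∈ U := (mem_filter.1 (Finset.mem_coe.1 hb)).2
  have : (a, b') ∈ U := by
    have hle : (a, b) ≤ (a, b') := ⟨le_rfl, hbb'⟩
    exact Finset.mem_coe.1 (hU hle (Finset.mem_coe.2 hb2))
  exact Finset.mem_coe.2 (mem_filter.2 ⟨mem_univ _, this⟩)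

omit [Fintype α] [Fintype β] in
/-- The fibres of an up-set of `α × β` increase along `α`. [cite: KozmaNitzan2024, Question 8 (§5.5 p. 36)] -/
theorem fib_mono_of_isUpperSet [Fintype β] [DecidableEq α] [DecidableEq β] (U : Finset (α × β))
    (hU : IsUpperSet (U : Set (α × β))) {a a' : α} (haa' : a ≤ a') :
    (univ.filter fun b => (a, b) ∈ U : Finset β) ⊆ univ.filter fun b => (a', b) ∈ U := by
  intro b hb
  have hb2 : (a, b) ∈ U := (mem_filter.1 hb).2
  have hle : (a, b) ≤ (a', b) := ⟨haa', le_rfl⟩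
  exact mem_filter.2 ⟨mem_univ _, Finset.mem_coe.1 (hU hle (Finset.mem_coe.2 hb2))⟩

/-- **Transport lemma 1.** If `w` has nonnegative mass on every up-set of `α` and `g ≥ 0` on `β`, then `(a,b) ↦ w a · g b` has nonnegative
mass on every up-set of `α × β` (fibrewise: `Σ_a w a · g(U_a)` with `g(U_a) ≥ 0` increasing in `a`; layer cake).
[cite: KozmaNitzan2024, Question 8 (§5.5 p. 36)] -/
theorem upperSets_nonneg_prod_of_nonneg_right (w : α → ℝ) (g : β → ℝ)
    (hw : ∀ V : Finset α, IsUpperSet (V : Set α) → 0 ≤ ∑ a ∈ V, w a) (hg : ∀ b, 0 ≤ g b)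
    (U : Finset (α × β)) (hU : IsUpperSet (U : Set (α × β))) :
    0 ≤ ∑ p ∈ U, w p.1 * g p.2 := by
  classical
  rw [sum_mul_eq_sum_fib]
  refine Literature.Probability.LatticeModels.sum_mul_nonneg_of_upperSets w _ hw ?_ ?_
  · intro a; exact Finset.sum_nonneg fun b _ => hg b
  · intro a a' haa'
    exact Finset.sum_le_sum_of_subset_of_nonneg (fib_mono_of_isUpperSet U hU haa') fun b _ _ => hg b

/-- **Transport lemma 2.** If `f ≥ 0` on `α` and `w` has nonnegative mass on every up-set of `β`, then `(a,b) ↦ f a · w b` has nonnegative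
mass on every up-set of `α × β` (the fibres are up-sets). [cite: KozmaNitzan2024, Question 8 (§5.5 p. 36)] -/
theorem upperSets_nonneg_prod_of_nonneg_left (f : α → ℝ) (w : β → ℝ)
    (hf : ∀ a, 0 ≤ f a) (hw : ∀ V : Finset β, IsUpperSet (V : Set β) → 0 ≤ ∑ b ∈ V, w b)
    (U : Finset (α × β)) (hU : IsUpperSet (U : Set (α × β))) :
    0 ≤ ∑ p ∈ U, f p.1 * w p.2 := by
  classical
  rw [sum_mul_eq_sum_fib]
  exact Finset.sum_nonneg fun a _ => mul_nonneg (hf a) (hw _ (fib_isUpperSet_of_isUpperSet U hU a))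

/-- **Row R1 of the K̂-cone tensorises** (memo PROOF-KHAT-TREES-G19 Lemma 4): if `a − c ≽ 0` on `α` with `c ≥ 0`, and `A − C ≽ 0` on `β` with
`A ≥ 0`, then `aA − cC ≽ 0` on `α × β`.  [`aA − cC = (a − c)A + c(A − C)`.] [cite: KozmaNitzan2024, Question 8 (§5.5 p. 36)] -/
theorem khatCone_R1_prod (a c : α → ℝ) (A C : β → ℝ)
    (hc : ∀ x, 0 ≤ c x) (hA : ∀ y, 0 ≤ A y)
    (hac : ∀ V : Finset α, IsUpperSet (V : Set α) → 0 ≤ ∑ x ∈ V, (a x - c x))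
    (hAC : ∀ V : Finset β, IsUpperSet (V : Set β) → 0 ≤ ∑ y ∈ V, (A y - C y))
    (U : Finset (α × β)) (hU : IsUpperSet (U : Set (α × β))) :
    0 ≤ ∑ p ∈ U, (a p.1 * A p.2 - c p.1 * C p.2) := by
  have e : ∀ p : α × β, a p.1 * A p.2 - c p.1 * C p.2 = (a p.1 - c p.1) * A p.2 + c p.1 * (A p.2 - C p.2) := by
    intro p; ring
  rw [Finset.sum_congr rfl fun p _ => e p, Finset.sum_add_distrib]
  exact add_nonneg (upperSets_nonneg_prod_of_nonneg_right _ _ hac hA U hU)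
    (upperSets_nonneg_prod_of_nonneg_left _ _ hc hAC U hU)

/-- **Row R2 of the K̂-cone tensorises** (memo PROOF-KHAT-TREES-G19 Lemma 4): with the pointwise rows `0 ≤ b ≤ a`, `0 ≤ d ≤ c` on `α` and
`0 ≤ B ≤ A`, `0 ≤ D ≤ C` on `β`, and the up-set rows `a − c ≽ 0`, `a − c − b + d ≽ 0` on `α`, `A − C ≽ 0`, `A − C − B + D ≽ 0` on `β`, the product
channels satisfy `aA − cC − bB + dD ≽ 0` on `α × β`.
[`aA − cC − bB + dD = (a−c)(A−B) + (a−c−b+d)B + (c−d)(A−C) + d(A−C−B+D)`; only `0 ≤ B ≤ A`, `0 ≤ d ≤ c` are used pointwise.]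
[cite: KozmaNitzan2024, Question 8 (§5.5 p. 36)] -/
theorem khatCone_R2_prod (a b c d : α → ℝ) (A B C D : β → ℝ)
    (hd : ∀ x, 0 ≤ d x) (hdc : ∀ x, d x ≤ c x) (hB : ∀ y, 0 ≤ B y) (hBA : ∀ y, B y ≤ A y)
    (hac : ∀ V : Finset α, IsUpperSet (V : Set α) → 0 ≤ ∑ x ∈ V, (a x - c x))
    (hacbd : ∀ V : Finset α, IsUpperSet (V : Set α) → 0 ≤ ∑ x ∈ V, (a x - c x - b x + d x))
    (hAC : ∀ V : Finset β, IsUpperSet (V : Set β) → 0 ≤ ∑ y ∈ V, (A y - C y))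
    (hACBD : ∀ V : Finset β, IsUpperSet (V : Set β) → 0 ≤ ∑ y ∈ V, (A y - C y - B y + D y))
    (U : Finset (α × β)) (hU : IsUpperSet (U : Set (α × β))) :
    0 ≤ ∑ p ∈ U, (a p.1 * A p.2 - c p.1 * C p.2 - b p.1 * B p.2 + d p.1 * D p.2) := by
  have e : ∀ p : α × β, a p.1 * A p.2 - c p.1 * C p.2 - b p.1 * B p.2 + d p.1 * D p.2 =
      ((a p.1 - c p.1) * (A p.2 - B p.2) + (a p.1 - c p.1 - b p.1 + d p.1) * B p.2) +
      ((c p.1 - d p.1) * (A p.2 - C p.2) + d p.1 * (A p.2 - C p.2 - B p.2 + D p.2)) := by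
    intro p; ring
  rw [Finset.sum_congr rfl fun p _ => e p, Finset.sum_add_distrib, Finset.sum_add_distrib, Finset.sum_add_distrib]
  refine add_nonneg (add_nonneg ?_ ?_) (add_nonneg ?_ ?_)
  · exact upperSets_nonneg_prod_of_nonneg_right (fun x => a x - c x) (fun y => A y - B y) hac
      (fun y => by linarith [hBA y]) U hU
  · exact upperSets_nonneg_prod_of_nonneg_right (fun x => a x - c x - b x + d x) B hacbd hB U hU
  · exact upperSets_nonneg_prod_of_nonneg_left (fun x => c x - d x) (fun y => A y - C y)
      (fun x => by linarith [hdc x]) hAC U hU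
  · exact upperSets_nonneg_prod_of_nonneg_left d (fun y => A y - C y - B y + D y) hd hACBD U hU

/-- **Sub-mean functions multiply** (memo PROOF-KHAT-TREES-G19 Lemma 6(ii), the engine of THEOREM A): if `u, u' ≥ 0` are weights and `f, g ≥ 0`
satisfy `Σ_V u·(m − f) ≥ 0` on every up-set `V ⊆ α` and `Σ_V u'·(m' − g) ≥ 0` on every up-set of `β` (with `m' ≥ 0`), then
`Σ_U (u⊗u')·(m m' − f⊗g) ≥ 0` on every up-set `U ⊆ α × β`.  [`m m' − f g = (m − f) m' + f (m' − g)`.] [cite: KozmaNitzan2024, Question 8 (§5.5 p. 36)] -/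
theorem subMean_prod (u f : α → ℝ) (u' g : β → ℝ) (m m' : ℝ)
    (hu' : ∀ y, 0 ≤ u' y) (hf : ∀ x, 0 ≤ f x) (hu : ∀ x, 0 ≤ u x) (hm' : 0 ≤ m')
    (hsub : ∀ V : Finset α, IsUpperSet (V : Set α) → 0 ≤ ∑ x ∈ V, u x * (m - f x))
    (hsub' : ∀ V : Finset β, IsUpperSet (V : Set β) → 0 ≤ ∑ y ∈ V, u' y * (m' - g y))
    (U : Finset (α × β)) (hU : IsUpperSet (U : Set (α × β))) :
    0 ≤ ∑ p ∈ U, (u p.1 * u' p.2) * (m * m' - f p.1 * g p.2) := by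
  have e : ∀ p : α × β, (u p.1 * u' p.2) * (m * m' - f p.1 * g p.2) =
      (u p.1 * (m - f p.1)) * (u' p.2 * m') + (u p.1 * f p.1) * (u' p.2 * (m' - g p.2)) := by
    intro p; ring
  rw [Finset.sum_congr rfl fun p _ => e p, Finset.sum_add_distrib]
  refine add_nonneg ?_ ?_
  · exact upperSets_nonneg_prod_of_nonneg_right (fun x => u x * (m - f x)) (fun y => u' y * m') hsub
      (fun y => mul_nonneg (hu' y) hm') U hU
  · exact upperSets_nonneg_prod_of_nonneg_left (fun x => u x * f x) (fun y => u' y * (m' - g y))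
      (fun x => mul_nonneg (hu x) (hf x)) hsub' U hU

end PocketCert

end Summit.CriticalPhenomena.PercolationContinuityZ3.Theorems
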